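import Summits.BirchSwinnertonDyer.Rank1Residual.Supersingular.CyclicityLadder
import Summits.BirchSwinnertonDyer.Rank1Residual.X11b.CertificateCheckBridge
import Literature.NumberTheory.EllipticCurves.HasseElementary
import HarnessLib

/-!
# Kernel POINT COUNT `#Ẽ(𝔽_ℓ) = n` at a LARGE prime `ℓ` from ONE point of certified order `m > 4√ℓ`
# (division-free ladders) and Hasse's theorem (PROVED in the tree) — an ORDER CERTIFICATE (TOOL)

Cell `b2b-bsdres`, supersingular family, prover A = unit `b2b-bsdres-x10b` (gen 14; N4 class lead).  Topic file;
namespace `Summit.BirchSwinnertonDyer.Rank1Residual.Supersingular`.  TOOL: elementary group theory + the ladder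
machinery of `CyclicityLadder.lean` (gen 13) + Hasse's theorem `WeierstrassCurve.abs_natCard_point_sub_le_of_ringChar_ne`
(`Literature/…/HasseElementary.lean`, Manin's elementary proof, sorry-free); one small computable definition
(`orderCertCheck`) and its soundness; no named fact, no `Prop` minted, nothing booked.

HONEST FRAMING (run/shared/lean/b2b/bsd-rank1-residual/, verbatim in every file): the goal of the
cell is to DELETE the COMBINATION-SHAPED residual classes of the Birch–Swinnerton-Dyer formula for
ALL analytic-rank `≤ 1` elliptic curves over `ℚ` — "full BSD formula for every rank `≤ 1` curve in
class `C`" assembled STRICTLY from published theorems — so that the rank-`≤ 1` remainder becomes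
exactly the CONSTRUCTION-SHAPED classes, which are TYPED (missing-input `Prop`s), NOT attempted.
This is not "finishing BSD".  Classes X6 / X7 / X8 stay CONSTRUCTION-SHAPED; nothing here moves a label.

## Why this file exists

Every per-pair Kurihara record of the cell reads the point count of the reduction `Ẽ = E mod ℓ` at each prime
`ℓ` of its Kolyvagin level from the schema's naive count `countPoints [a₁,…,a₆] ℓ = n` (an `ℓ`-term Euler-criterion
sum evaluated by `decide +kernel`: `CountPointsFast.lean`, one `decide` up to `ℓ ≈ 13 000`; `CountPointsChunked.lean`,
one `decide` per chunk of `≈ 12 000` beyond).  The N4 TAM-DEFECT route of this generation (a SINGLE Kolyvagin prime of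
depth `t + 2`, `X6KimTamDefectSquareShape.lean`) and the deeper rank-one levels of N5 / O4 / O3 live at
`ℓ ≈ 10⁵ … 10⁷`, where an `ℓ`-term kernel sum is out of the question.  Here the count costs `O(log ℓ)` kernel steps:

* §1 arithmetic: two multiples of `m` at squared distance `< m²` coincide; a prime dividing a product of prime
  powers is one of the bases.
* §2 `orderCertCheck V ℓ x₀ y₀ m negSteps fac` (Bool, `decide`d per record): `P₀ = (x₀, y₀)` lies on `V mod ℓ`; a
  ladder for `(m − 1) • P₀` ending at `−P₀ = (x₀, −y₀ − a₁x₀ − a₃)`; `m = ∏ q^e` over the listed factors; for each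
  listed `q` a ladder for `(m/q) • P₀` ending at an AFFINE point.  Soundness (`exists_addOrderOf_eq_of_orderCertCheck`):
  with the listed `q` prime, `P₀` has order exactly `m` (`addOrderOf_eq_of_nsmul_and_div_prime_nsmul`).
* §3 `natCard_point_eq_of_orderCert`: if moreover `m ∣ n`, `16 ℓ < m²` and `(n − ℓ − 1)² ≤ 4ℓ` (all decidable), then
  `#Ẽ(𝔽_ℓ) = n` — because `m ∣ #Ẽ(𝔽_ℓ)` (Lagrange) and, by HASSE (`ℓ ≥ 5`), both `#Ẽ(𝔽_ℓ)` and `n` lie within `2√ℓ`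
  of `ℓ + 1`, so `(#Ẽ − n)² ≤ 16 ℓ < m²`.  (Mestre's order-certificate; no enumeration of `𝔽_ℓ`.)
* §4 the literal-model RECORD forms `countPoints_eq_of_orderCert` (the exact hypothesis shape `countPoints [a₁,…,a₆] ℓ = n`
  every record shape of the cell consumes, via x11c's `natCard_point_eq_countPoints`) and
  `card_torsion_le_of_orderCert_of_ladder` (cyclicity `#Ẽ(𝔽_ℓ)[p] ≤ p` from the count so obtained + one more ladder).

A record thus writes `countPoints_eq_of_orderCert … (by decide +kernel) (by decide) (by decide) (by decide) …` where it
used to write `countPoints_eq_of_fast (by decide +kernel)`; the certificate (point, order, factorisation, `1 + ω(m)`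
ladders of `≈ log₂ ℓ` steps) is found by any CAS in milliseconds and CHECKED here.

References: J.-F. Mestre, "Formules explicites et minorations de conducteurs…" / Schoof 1985 §3 (order of a point pins
`#E(𝔽_p)` inside the Hasse interval) — method only, nothing cited as a fact; J. H. Silverman, *AEC* (2009) III.2.3
(group law), V.1.1 (Hasse) [SilvermanAEC2009]; A. W. Knapp, *Elliptic Curves* (1992) Thm. 10.5 (Manin's proof, the
tree's `HasseElementary`) [Knapp1993]; K. Ireland – M. Rosen, GTM 84, Prop. 5.1.2 [IrelandRosen1990].
-/

set_option autoImplicit false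

open WeierstrassCurve Literature.NumberTheory.EllipticCurves.Rank1Residual.X11RankOneCertificates

namespace Summit.BirchSwinnertonDyer.Rank1Residual.Supersingular

/-! ### §1 Arithmetic -/

/-- Two integers whose difference is a multiple of `m` at squared distance `< m²` are equal (for `m = 0` the
difference is `0` outright). [folklore] -/
theorem int_eq_of_dvd_sub_of_sq_lt {m c n : ℤ} (hd : m ∣ c - n) (hlt : (c - n) ^ 2 < m ^ 2) :
    c = n := by
  obtain ⟨d, hd⟩ := hd
  have hd0 : d = 0 := by
    by_contra h
    have h1 : 1 ≤ d ^ 2 := by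
      rcases lt_or_gt_of_ne h with h' | h'
      · nlinarith
      · nlinarith
    rw [hd] at hlt
    nlinarith [sq_nonneg m]
  rw [hd0, mul_zero] at hd
  linarith

/-- One prime-power factor of an order certificate: the prime `q`, its exponent `e` in `m`, and a ladder for
`(m / q) • P₀` (which must end at an affine point). [folklore] -/
structure OrderCertFactor where
  /-- a prime factor of `m` -/ q : ℕ
  /-- its exponent in `m` -/ e : ℕ
  /-- ladder for `(m / q) • P₀` -/ steps : List LadderStep

/-- A prime dividing `∏ q^e` over a list of PRIME bases `q` is one of the bases. [folklore] -/
theorem exists_mem_of_prime_dvd_prod (fac : List OrderCertFactor) (hfac : ∀ f ∈ fac, f.q.Prime) {q : ℕ}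
    (hq : q.Prime) (hd : q ∣ (fac.map fun f => f.q ^ f.e).prod) : ∃ f ∈ fac, q = f.q := by
  induction fac with
  | nil =>
    simp only [List.map_nil, List.prod_nil, Nat.dvd_one] at hd
    exact absurd hd hq.one_lt.ne'
  | cons f rest ih =>
    rw [List.map_cons, List.prod_cons] at hd
    rcases (Nat.Prime.dvd_mul hq).mp hd with h | h
    · refine ⟨f, by simp, ?_⟩
      exact (Nat.prime_dvd_prime_iff_eq hq (hfac f (by simp))).mp (hq.dvd_of_dvd_pow h)
    · obtain ⟨f', hmem, rfl⟩ := ih (fun x hx => hfac x (by simp [hx])) h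
      exact ⟨f', by simp [hmem], rfl⟩

/-! ### §2 The order certificate and its soundness -/

/-- **Order certificate check** (Bool, decided in the kernel per record): `(x₀, y₀)` is on `V mod ℓ`; the ladder
`negSteps` computes `(m − 1) • P₀` and ends at `−P₀ = (x₀, −y₀ − a₁x₀ − a₃)`; `m = ∏ q^e` over `fac`; and for every
listed factor the ladder computes `(m / q) • P₀` (`ladderScalar · q = m`) and ends at an AFFINE point.
[cite: SilvermanAEC2009, III.2.3] -/
def orderCertCheck (V : WeierstrassCurve ℤ) (ℓ : ℕ) (x₀ y₀ : ℤ) (m : ℕ) (negSteps : List LadderStep)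
    (fac : List OrderCertFactor) : Bool :=
  decide ((y₀ : ZMod ℓ) ^ 2 + (V.a₁ : ZMod ℓ) * (x₀ : ZMod ℓ) * (y₀ : ZMod ℓ) + (V.a₃ : ZMod ℓ) * (y₀ : ZMod ℓ) =
    (x₀ : ZMod ℓ) ^ 3 + (V.a₂ : ZMod ℓ) * (x₀ : ZMod ℓ) ^ 2 + (V.a₄ : ZMod ℓ) * (x₀ : ZMod ℓ) + (V.a₆ : ZMod ℓ)) &&
  (ladderScalar 1 negSteps + 1 == m) &&
  decide (ladderRun V ℓ (x₀ : ZMod ℓ) (y₀ : ZMod ℓ) (x₀ : ZMod ℓ) (y₀ : ZMod ℓ) negSteps =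
    some ((x₀ : ZMod ℓ), -(y₀ : ZMod ℓ) - (V.a₁ : ZMod ℓ) * (x₀ : ZMod ℓ) - (V.a₃ : ZMod ℓ))) &&
  ((fac.map fun f => f.q ^ f.e).prod == m) &&
  fac.all (fun f => (ladderScalar 1 f.steps * f.q == m) &&
    (ladderRun V ℓ (x₀ : ZMod ℓ) (y₀ : ZMod ℓ) (x₀ : ZMod ℓ) (y₀ : ZMod ℓ) f.steps).isSome)

variable {V : WeierstrassCurve ℤ} {ℓ : ℕ}

/-- `ℓ ∤ Δ(V)` ⟹ the discriminant of `V mod ℓ` is non-zero. [folklore] -/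
theorem map_Δ_ne_zero (hℓΔ : ¬ (ℓ : ℤ) ∣ V.Δ) : (V.map (Int.castRingHom (ZMod ℓ))).Δ ≠ 0 := by
  intro h
  have h' : ((V.Δ : ℤ) : ZMod ℓ) = 0 := by
    have := (V.map_Δ (Int.castRingHom (ZMod ℓ))).symm.trans h
    simpa using this
  exact hℓΔ ((ZMod.intCast_zmod_eq_zero_iff_dvd _ _).mp h')

variable [Fact ℓ.Prime]

/-- **Soundness of the order certificate**: if `orderCertCheck V ℓ x₀ y₀ m negSteps fac` passes, the listed bases
are prime and `ℓ ∤ Δ`, then `P₀ = (x₀, y₀) ∈ Ẽ(𝔽_ℓ)` has order EXACTLY `m`: `m • P₀ = (m−1) • P₀ + P₀ = −P₀ + P₀ = O`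
and `(m/q) • P₀ ≠ O` for every prime `q ∣ m` (`addOrderOf_eq_of_nsmul_and_div_prime_nsmul`). [cite: SilvermanAEC2009, III.2.3] -/
theorem exists_addOrderOf_eq_of_orderCertCheck (x₀ y₀ : ℤ) (m : ℕ) (negSteps : List LadderStep)
    (fac : List OrderCertFactor) (hcheck : orderCertCheck V ℓ x₀ y₀ m negSteps fac = true)
    (hfac : ∀ f ∈ fac, f.q.Prime) (hℓΔ : ¬ (ℓ : ℤ) ∣ V.Δ) :
    ∃ P : (V.map (Int.castRingHom (ZMod ℓ))).toAffine.Point, addOrderOf P = m := by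
  obtain ⟨ha₁, ha₂, ha₃, ha₄, ha₆⟩ := map_a_eq V ℓ
  simp only [orderCertCheck, Bool.and_eq_true, decide_eq_true_eq, beq_iff_eq, List.all_eq_true] at hcheck
  obtain ⟨⟨⟨⟨heq, hsc⟩, hneg⟩, hprod⟩, hall⟩ := hcheck
  have hΔ : (V.map (Int.castRingHom (ZMod ℓ))).toAffine.Δ ≠ 0 := map_Δ_ne_zero hℓΔ
  have h₀ : (V.map (Int.castRingHom (ZMod ℓ))).toAffine.Nonsingular (x₀ : ZMod ℓ) (y₀ : ZMod ℓ) := by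
    refine (Affine.equation_iff_nonsingular_of_Δ_ne_zero hΔ).mp ((Affine.equation_iff _ _).mpr ?_)
    rw [ha₁, ha₂, ha₃, ha₄, ha₆]; exact heq
  set P₀ : (V.map (Int.castRingHom (ZMod ℓ))).toAffine.Point := Affine.Point.some _ _ h₀ with hP₀
  have hm0 : 0 < m := by omega
  -- `(m - 1) • P₀ = -P₀`
  obtain ⟨hf, hP⟩ := ladderRun_sound h₀ negSteps 1 _ _ h₀ (one_nsmul _) _ _ hneg
  have hneg' : (m - 1) • P₀ = -P₀ := by
    rw [show m - 1 = ladderScalar 1 negSteps by omega, hP₀, hP, Affine.Point.neg_some]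
    obtain ⟨h', e⟩ := exists_some_eq_of_eq hf rfl
      (show -(y₀ : ZMod ℓ) - (V.a₁ : ZMod ℓ) * (x₀ : ZMod ℓ) - (V.a₃ : ZMod ℓ) =
        (V.map (Int.castRingHom (ZMod ℓ))).toAffine.negY (x₀ : ZMod ℓ) (y₀ : ZMod ℓ) by
        simp only [Affine.negY, ha₁, ha₃])
    exact e
  have hmP : m • P₀ = 0 := by
    rw [show m = (m - 1) + 1 by omega, add_nsmul, one_nsmul, hneg', neg_add_cancel]
  -- `(m / q) • P₀ ≠ O` for every prime `q ∣ m`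
  have hdiv : ∀ q : ℕ, q.Prime → q ∣ m → (m / q) • P₀ ≠ 0 := by
    intro q hq hqm
    rw [← hprod] at hqm
    obtain ⟨f, hfmem, rfl⟩ := exists_mem_of_prime_dvd_prod fac hfac hq hqm
    obtain ⟨hs, hrun⟩ := hall f hfmem
    obtain ⟨⟨xf, yf⟩, hrun'⟩ := Option.isSome_iff_exists.mp hrun
    obtain ⟨hf', hP'⟩ := ladderRun_sound h₀ f.steps 1 _ _ h₀ (one_nsmul _) xf yf hrun'
    rw [show m / f.q = ladderScalar 1 f.steps by rw [← hs, Nat.mul_div_cancel _ hq.pos], hP₀, hP']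
    exact Affine.Point.some_ne_zero hf'
  exact ⟨P₀, addOrderOf_eq_of_nsmul_and_div_prime_nsmul hm0 hmP hdiv⟩

/-! ### §3 The point count from the order certificate and Hasse's theorem -/

/-- **`#Ẽ(𝔽_ℓ) = n` FROM AN ORDER CERTIFICATE** (`ℓ ≥ 5` prime, `ℓ ∤ Δ`): a point of certified order `m` with
`m ∣ n`, `16 ℓ < m²` and `(n − ℓ − 1)² ≤ 4 ℓ`.  Proof: `m ∣ #Ẽ(𝔽_ℓ)` (Lagrange) and `|#Ẽ(𝔽_ℓ) − (ℓ + 1)| ≤ 2√ℓ`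
(HASSE, the tree's `WeierstrassCurve.abs_natCard_point_sub_le_of_ringChar_ne`), so `(#Ẽ − n)² ≤ 16 ℓ < m²` with
`m ∣ #Ẽ − n`, whence `#Ẽ = n`.  The decidable hypotheses come first so that a record's `decide`s are closed terms.
[cite: SilvermanAEC2009, Thm. V.1.1] [cite: Knapp1993, Thm. 10.5] -/
theorem natCard_point_eq_of_orderCert (x₀ y₀ : ℤ) (m n : ℕ) (negSteps : List LadderStep)
    (fac : List OrderCertFactor) (hcheck : orderCertCheck V ℓ x₀ y₀ m negSteps fac = true)
    (hmn : m ∣ n) (h16 : 16 * ℓ < m * m) (hn : ((n : ℤ) - ℓ - 1) ^ 2 ≤ 4 * ℓ)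
    (hfac : ∀ f ∈ fac, f.q.Prime) (hℓ5 : 5 ≤ ℓ) (hℓΔ : ¬ (ℓ : ℤ) ∣ V.Δ) :
    Nat.card (V.map (Int.castRingHom (ZMod ℓ))).toAffine.Point = n := by
  obtain ⟨P, hP⟩ := exists_addOrderOf_eq_of_orderCertCheck x₀ y₀ m negSteps fac hcheck hfac hℓΔ
  set c : ℕ := Nat.card (V.map (Int.castRingHom (ZMod ℓ))).toAffine.Point with hc
  have hm0 : 0 < m := by
    simp only [orderCertCheck, Bool.and_eq_true, beq_iff_eq] at hcheck; omega
  have hmc : m ∣ c := hP ▸ addOrderOf_dvd_natCard P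
  -- Hasse
  haveI : (V.map (Int.castRingHom (ZMod ℓ))).IsElliptic := ⟨isUnit_iff_ne_zero.mpr (map_Δ_ne_zero hℓΔ)⟩
  have h2 : ringChar (ZMod ℓ) ≠ 2 := by rw [ZMod.ringChar_zmod_n]; omega
  have h3 : ringChar (ZMod ℓ) ≠ 3 := by rw [ZMod.ringChar_zmod_n]; omega
  have hH := WeierstrassCurve.abs_natCard_point_sub_le_of_ringChar_ne (V.map (Int.castRingHom (ZMod ℓ))) h2 h3
  rw [ZMod.card] at hH
  have hℓ0 : (0 : ℝ) ≤ (ℓ : ℝ) := by positivity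
  have hsq : (2 * Real.sqrt ℓ) ^ 2 = 4 * (ℓ : ℝ) := by
    rw [mul_pow, Real.sq_sqrt hℓ0]; norm_num
  have hcR : ((c : ℝ) - ((ℓ : ℝ) + 1)) ^ 2 ≤ 4 * (ℓ : ℝ) := by
    rw [← hsq]
    exact sq_le_sq' (by linarith [(abs_le.mp hH).1]) (abs_le.mp hH).2
  have hcZ : ((c : ℤ) - ℓ - 1) ^ 2 ≤ 4 * ℓ := by
    have : ((c : ℝ) - (ℓ : ℝ) - 1) ^ 2 ≤ 4 * (ℓ : ℝ) := by
      have e : (c : ℝ) - (ℓ : ℝ) - 1 = (c : ℝ) - ((ℓ : ℝ) + 1) := by ring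
      rw [e]; exact hcR
    exact_mod_cast this
  -- `(c - n)² ≤ 2 (c - ℓ - 1)² + 2 (n - ℓ - 1)² ≤ 16 ℓ < m²`
  have key : ((c : ℤ) - n) ^ 2 < (m : ℤ) ^ 2 := by
    have h16' : (16 : ℤ) * ℓ < (m : ℤ) * m := by exact_mod_cast h16
    nlinarith [sq_nonneg ((c : ℤ) - ℓ - 1 + ((n : ℤ) - ℓ - 1))]
  have hmcZ : (m : ℤ) ∣ (c : ℤ) := Int.natCast_dvd_natCast.mpr hmc
  have hmnZ : (m : ℤ) ∣ (n : ℤ) := Int.natCast_dvd_natCast.mpr hmn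
  exact_mod_cast int_eq_of_dvd_sub_of_sq_lt (dvd_sub hmcZ hmnZ) key

/-! ### §4 Record forms (literal integer model) -/

section Record

open Summit.BirchSwinnertonDyer.BirchSwinnertonDyer.Rank1Residual.X11RankOne (intCurve_Δ)
open Summit.BirchSwinnertonDyer.Rank1Residual.X11b (natCard_point_eq_countPoints)

/-- **THE SCHEMA COUNT `countPoints [a₁,…,a₆] ℓ = n` FROM AN ORDER CERTIFICATE** — the hypothesis shape every
record shape of the cell consumes (x11c's `natCard_point_eq_countPoints`: at an odd prime `ℓ ∤ Δ` the schema's naive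
count IS `#Ẽ(𝔽_ℓ)`), now certified in `O(log ℓ)` kernel steps: `orderCertCheck` (`decide +kernel`), `m ∣ n`,
`16 ℓ < m²`, `(n − ℓ − 1)² ≤ 4 ℓ` (`decide`), the listed bases prime (`norm_num`), `ℓ ≥ 5`, `ℓ ∤ Δ`.
[cite: SilvermanAEC2009, Thm. V.1.1 and III.2.3] [cite: IrelandRosen1990, Prop. 5.1.2 and §8.1] -/
theorem countPoints_eq_of_orderCert (a1 a2 a3 a4 a6 : ℤ) (ℓ : ℕ) (x₀ y₀ : ℤ) (m n : ℕ)
    (negSteps : List LadderStep) (fac : List OrderCertFactor)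
    (hcheck : orderCertCheck ⟨a1, a2, a3, a4, a6⟩ ℓ x₀ y₀ m negSteps fac = true)
    (hmn : m ∣ n) (h16 : 16 * ℓ < m * m) (hn : ((n : ℤ) - ℓ - 1) ^ 2 ≤ 4 * ℓ)
    [Fact ℓ.Prime] (hfac : ∀ f ∈ fac, f.q.Prime) (hℓ5 : 5 ≤ ℓ)
    (hℓΔ : ¬ (ℓ : ℤ) ∣ discOf [a1, a2, a3, a4, a6]) :
    countPoints [a1, a2, a3, a4, a6] ℓ = n := by
  have hΔ : ¬ (ℓ : ℤ) ∣ (⟨a1, a2, a3, a4, a6⟩ : WeierstrassCurve ℤ).Δ := by rw [intCurve_Δ]; exact hℓΔ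
  rw [← natCard_point_eq_countPoints a1 a2 a3 a4 a6 ℓ (by omega) hΔ,
    natCard_point_eq_of_orderCert x₀ y₀ m n negSteps fac hcheck hmn h16 hn hfac hℓ5 hΔ]

/-- **`#Ẽ(𝔽_ℓ) = n` for the literal model from an order certificate** (the `Nat.card` form some shapes take directly).
[cite: SilvermanAEC2009, Thm. V.1.1 and III.2.3] -/
theorem natCard_point_eq_of_orderCert_intModel (a1 a2 a3 a4 a6 : ℤ) (ℓ : ℕ) (x₀ y₀ : ℤ) (m n : ℕ)
    (negSteps : List LadderStep) (fac : List OrderCertFactor)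
    (hcheck : orderCertCheck ⟨a1, a2, a3, a4, a6⟩ ℓ x₀ y₀ m negSteps fac = true)
    (hmn : m ∣ n) (h16 : 16 * ℓ < m * m) (hn : ((n : ℤ) - ℓ - 1) ^ 2 ≤ 4 * ℓ)
    [Fact ℓ.Prime] (hfac : ∀ f ∈ fac, f.q.Prime) (hℓ5 : 5 ≤ ℓ)
    (hℓΔ : ¬ (ℓ : ℤ) ∣ discOf [a1, a2, a3, a4, a6]) :
    Nat.card (((⟨a1, a2, a3, a4, a6⟩ : WeierstrassCurve ℤ)).map
      (Int.castRingHom (ZMod ℓ))).toAffine.Point = n :=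
  natCard_point_eq_of_orderCert x₀ y₀ m n negSteps fac hcheck hmn h16 hn hfac hℓ5
    (by rw [intCurve_Δ]; exact hℓΔ)

/-- **CYCLICITY `#Ẽ(𝔽_ℓ)[p] ≤ p` at a large prime from an order certificate + one ladder**: the count by
`countPoints_eq_of_orderCert`, then `card_torsion_le_of_ladder` (a point whose `(n/p)`-multiple is affine).
[cite: Kim2022StructureSelmer, §1.2.2 and Thm. 1.10 (1)] [cite: SilvermanAEC2009, III.2.3 and Thm. V.1.1] -/
theorem card_torsion_le_of_orderCert_of_ladder (a1 a2 a3 a4 a6 : ℤ) (ℓ p : ℕ)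
    -- order certificate
    (x₀ y₀ : ℤ) (m n : ℕ) (negSteps : List LadderStep) (fac : List OrderCertFactor)
    (hcheck : orderCertCheck ⟨a1, a2, a3, a4, a6⟩ ℓ x₀ y₀ m negSteps fac = true)
    (hmn : m ∣ n) (h16 : 16 * ℓ < m * m) (hn : ((n : ℤ) - ℓ - 1) ^ 2 ≤ 4 * ℓ)
    -- cyclicity ladder
    (x₁ y₁ : ℤ) (steps : List LadderStep)
    (hlad : ladderCheck ⟨a1, a2, a3, a4, a6⟩ ℓ x₁ y₁ steps = true) (hm : ladderScalar 1 steps * p = n)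
    [Fact ℓ.Prime] [Fact p.Prime] (hfac : ∀ f ∈ fac, f.q.Prime) (hℓ5 : 5 ≤ ℓ)
    (hℓΔ : ¬ (ℓ : ℤ) ∣ discOf [a1, a2, a3, a4, a6]) :
    Nat.card {P : (((⟨a1, a2, a3, a4, a6⟩ : WeierstrassCurve ℤ)).map
        (Int.castRingHom (ZMod ℓ))).toAffine.Point // p • P = 0} ≤ p :=
  card_torsion_le_of_ladder a1 a2 a3 a4 a6 ℓ p x₁ y₁ steps hlad hm (by omega) hℓΔ
    (countPoints_eq_of_orderCert a1 a2 a3 a4 a6 ℓ x₀ y₀ m n negSteps fac hcheck hmn h16 hn hfac hℓ5 hℓΔ)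

end Record

/-! ### §5 Sanity instance (kernel `decide`) -/

section Sanity

/-- Sanity (kernel `decide`): `145146q1` mod `ℓ = 2551` (`#Ẽ(𝔽₂₅₅₁) = 2600 = 2³·5²·13`, the depth-2 Kolyvagin prime of
`bsdp_x6r0tamL_145146q1_5`): the point `(0, 2290)` has order `650 = 2·5²·13 > 4√2551` — ladders for `649 • P = −P`,
`325 • P`, `130 • P`, `50 • P` affine — so `#Ẽ(𝔽₂₅₅₁) = 2600`, the same number `CountPointsFast` returns there.
[cite: SilvermanAEC2009, Thm. V.1.1 and III.2.3] -/
theorem countPoints_orderCert_sample [Fact (Nat.Prime 2551)] :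
    countPoints [1, 0, 1, -3229945761, -70654953055340] 2551 = 2600 :=
  countPoints_eq_of_orderCert 1 0 1 (-3229945761) (-70654953055340) 2551 0 2290 650 2600
    [⟨false, 1409, 2012, 52, 0, 0, 0⟩, ⟨true, 19, 1458, 1362, 1854, 1515, 1137⟩, ⟨false, 951, 1819, 1304, 0, 0, 0⟩, ⟨false, 1583, 1303, 451, 0, 0, 0⟩,
      ⟨false, 1016, 62, 148, 0, 0, 0⟩, ⟨true, 1063, 815, 2162, 870, 1859, 956⟩, ⟨false, 98, 882, 2071, 0, 0, 0⟩, ⟨false, 127, 1737, 2401, 0, 0, 0⟩,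
      ⟨true, 446, 2012, 486, 1409, 0, 260⟩]
    [⟨2, 1, [⟨false, 1409, 2012, 52, 0, 0, 0⟩, ⟨true, 19, 1458, 1362, 1854, 1515, 1137⟩, ⟨false, 951, 1819, 1304, 0, 0, 0⟩,
        ⟨false, 1583, 1303, 451, 0, 0, 0⟩, ⟨false, 1016, 62, 148, 0, 0, 0⟩, ⟨true, 1063, 815, 2162, 870, 1859, 956⟩, ⟨false, 98, 882, 2071, 0, 0, 0⟩,
        ⟨true, 127, 1737, 2401, 2203, 1673, 1714⟩]⟩,
      ⟨5, 2, [⟨false, 1409, 2012, 52, 0, 0, 0⟩, ⟨false, 19, 1458, 1362, 0, 0, 0⟩, ⟨false, 1925, 582, 695, 0, 0, 0⟩, ⟨false, 30, 2317, 1059, 0, 0, 0⟩,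
        ⟨false, 1796, 865, 1296, 0, 0, 0⟩, ⟨true, 1315, 1783, 1475, 2097, 2350, 1043⟩, ⟨false, 329, 1830, 2391, 0, 0, 0⟩]⟩,
      ⟨13, 1, [⟨true, 1409, 2012, 52, 184, 1416, 1053⟩, ⟨false, 238, 479, 2087, 0, 0, 0⟩, ⟨false, 301, 659, 1746, 0, 0, 0⟩,
        ⟨true, 738, 701, 2270, 524, 1442, 857⟩, ⟨false, 430, 1325, 2209, 0, 0, 0⟩]⟩]
    (by decide +kernel) (by decide) (by decide) (by decide)
    (by intro f hf; fin_cases hf <;> norm_num) (by norm_num) (by decide)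

end Sanity

end Summit.BirchSwinnertonDyer.Rank1Residual.Supersingular
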